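import Summits.CriticalPhenomena.SAWScalingLimit.Theorems.FKGToTraversalBound.Negative.DeepEndpointGap

/-!
# CARVE core for the crux `SAWLeftRightFKG.FKGToTraversalBound` (stmt-CriticalPhenomena-1878): the up×down
complement form of left–right positive association

Line `excursion-domination` (lead), registered sub-goal `stub_carveCore`; the same lemma is the formal core of
CARVE / FILL / the sandwich monotonicities of the sibling lines `carve-reroot-drill` (`carveCore_of_leftRightFKG` in
its skeleton, whence this proof is adapted) and `lid-collapse-needle` ((M−)/(M+)), triage X3 of the crux panel:
"one `--supports` lemma for the three PA cards".

* `inter_mul_univ_le_of_PA` — abstract: a finite measure that is positively associated for a relation `le`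
  (`w(A) w(B) ≤ w(univ) w(A ∩ B)` for `le`-up-closed `A, B`) makes an up-closed `E` and a DOWN-closed `D`
  negatively correlated: `w(E ∩ D) · w(univ) ≤ w(E) · w(D)` (PA for `E` and `Dᶜ`, cancel the finite cross term).
* `stub_carveCore` — the route's order `lrLE` and weight `SAW.weight` on the crux's own carriers `dom C δ`
  (`Negative.DeepEndpointGap`): under `LeftRightFKG`, with finite total weight, every `≼`-up-closed event `E` (e.g.
  "the chord enters a pocket hanging off one arc") and `≼`-down-closed event `D` (e.g. "the chord avoids a hull
  attached to that arc", whose conditioning is the chord law of the carved domain by exact restriction) satisfy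
  `w(E ∩ D)·w(univ) ≤ w(E)·w(D)`.

No named fact is used; axioms are the standard three.
-/

noncomputable section

open MeasureTheory Set
open Literature.Probability.LatticeModels Literature.Probability.RandomPlanarGeometry
open Summit.CriticalPhenomena.SAWScalingLimit.Theses.SAWLeftRightFKG
open Summit.CriticalPhenomena.SAWScalingLimit.Theorems.FKGToTraversalBound.Negative (dom lrLE)

namespace Summit.CriticalPhenomena.SAWScalingLimit.Theorems.FKGToTraversalBound.ExcursionDomination

/-- **PA in complement form.**  If a measure `w` of finite total mass is positively associated for a relation
`le` (`w(A) w(B) ≤ w(univ) w(A ∩ B)` for `le`-up-closed `A, B`), then an up-closed `E` and a DOWN-closed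
measurable `D` are negatively correlated: `w(E ∩ D) · w(univ) ≤ w(E) · w(D)`.  (Apply PA to `E` and `Dᶜ`, split
`w(E) = w(E ∩ D) + w(E ∩ Dᶜ)` and `w(univ) = w(D) + w(Dᶜ)`, cancel the finite cross term.)  Adapted from the
skeleton `Cruxes/FKGToTraversalBound/Lines/carve-reroot-drill.lean`. -/
theorem inter_mul_univ_le_of_PA {ι : Type*} [MeasurableSpace ι] {le : ι → ι → Prop} {w : Measure ι}
    (hPA : ∀ A B : Set ι, (∀ γ₁ γ₂, le γ₁ γ₂ → γ₁ ∈ A → γ₂ ∈ A) →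
      (∀ γ₁ γ₂, le γ₁ γ₂ → γ₁ ∈ B → γ₂ ∈ B) → w A * w B ≤ w Set.univ * w (A ∩ B))
    (hU : w Set.univ ≠ ⊤) {E D : Set ι} (hDm : MeasurableSet D)
    (hE : ∀ γ₁ γ₂, le γ₁ γ₂ → γ₁ ∈ E → γ₂ ∈ E) (hD : ∀ γ₁ γ₂, le γ₁ γ₂ → γ₂ ∈ D → γ₁ ∈ D) :
    w (E ∩ D) * w Set.univ ≤ w E * w D := by
  have hDc : ∀ γ₁ γ₂, le γ₁ γ₂ → γ₁ ∈ Dᶜ → γ₂ ∈ Dᶜ := fun γ₁ γ₂ h h₁ h₂ => h₁ (hD γ₁ γ₂ h h₂)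
  have key := hPA E Dᶜ hE hDc
  have fin : ∀ S : Set ι, w S ≠ ⊤ := fun S =>
    ((measure_mono (Set.subset_univ S)).trans_lt hU.lt_top).ne
  set a := w (E ∩ D) with ha
  set b := w (E ∩ Dᶜ) with hb
  set d := w D with hd
  set d' := w Dᶜ with hd'
  have hEsplit : w E = a + b := by
    rw [ha, hb, ← Set.sdiff_eq]
    exact (measure_inter_add_sdiff E hDm).symm
  have hUsplit : w Set.univ = d + d' := by
    rw [hd, hd']
    exact (measure_add_measure_compl hDm).symm
  rw [hEsplit, hUsplit] at key
  have h1 : a * d' + b * d' ≤ d * b + b * d' := by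
    calc a * d' + b * d' = (a + b) * d' := by ring
      _ ≤ (d + d') * b := key
      _ = d * b + b * d' := by ring
  have hbd' : b * d' ≠ ⊤ := ENNReal.mul_ne_top (fin _) (fin _)
  have h2 : a * d' ≤ d * b := (ENNReal.add_le_add_iff_right hbd').1 h1
  calc a * w Set.univ = a * d + a * d' := by rw [hUsplit]; ring
    _ ≤ a * d + d * b := add_le_add le_rfl h2
    _ = (a + b) * d := by ring
    _ = w E * d := by rw [hEsplit]

/-- **CARVE core for the route's order and weight** (registered sub-goal `stub_carveCore` of the crux
stmt-CriticalPhenomena-1878): under `LeftRightFKG`, in every domain of its class — mesh `δ > 0`, boundary walk `C`,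
carrier `dom C δ = {z | wind(δ-polyline of C, z) ≠ 0}`, endpoints `a ∼ a'`, `b ∼ b'` with `a', b'` vertices of `C`
— and for finite total weight, an `lrLE`-up-closed event `E` and an `lrLE`-down-closed event `D` satisfy
`w(E ∩ D)·w(univ) ≤ w(E)·w(D)` for `w = SAW.weight (dom C δ) δ a b`.  (Finiteness holds for every `δ > 0` since
`dom C δ` is bounded; it is kept as a hypothesis so that the lemma is literally PA's complement form.) -/
theorem stub_carveCore : LeftRightFKG → ∀ (δ : ℝ) (c a b a' b' : Site 2) (C : (zdGraph 2).Walk c c),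
    0 < δ → a' ∈ C.support → b' ∈ C.support → (zdGraph 2).Adj a a' → (zdGraph 2).Adj b b' →
    SAW.weight (dom C δ) δ a b Set.univ ≠ ⊤ →
    ∀ (E D : Set (SAW.DomainSAW (dom C δ) δ a b)),
      (∀ γ₁ γ₂, lrLE γ₁ γ₂ → γ₁ ∈ E → γ₂ ∈ E) → (∀ γ₁ γ₂, lrLE γ₁ γ₂ → γ₂ ∈ D → γ₁ ∈ D) →
      SAW.weight (dom C δ) δ a b (E ∩ D) * SAW.weight (dom C δ) δ a b Set.univ ≤
        SAW.weight (dom C δ) δ a b E * SAW.weight (dom C δ) δ a b D := by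
  intro hPA δ c a b a' b' C hδ ha' hb' haa hbb hU E D hE hD
  exact inter_mul_univ_le_of_PA (le := lrLE (Ω := dom C δ) (δ := δ) (a := a) (b := b))
    (hPA δ c a b a' b' C hδ ha' hb' haa hbb) hU MeasurableSpace.measurableSet_top hE hD

end Summit.CriticalPhenomena.SAWScalingLimit.Theorems.FKGToTraversalBound.ExcursionDomination

end
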